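import Mathlib
import HarnessLib
import Summits.HubbardSuperconductivity.HubbardSuperconductivity.Theorems.KLProgrammeKLRegimeEngineTowerLevReadoutProfileF
import Summits.HubbardSuperconductivity.HubbardSuperconductivity.Theorems.KLProgrammeKLRegimeEngineTowerLevReadoutFit

/-!
# Route `KLProgramme` — crux K3 ENGINE (stmt-HubbardSuperconductivity-20437 `KLRegimeEngineV17F2`), stub (b) v2, THE LEVELS PACKAGE (ℓ), located item
# «(ℓ)-READOUT-F» piece RO-4″: THE PARTIAL-BLOCK INCREMENT BORN AT `F_{dk}` AND READ AT `F_j` — the floor jump of a bound in floor units (any momentum-conserving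
# element), the momentum conservation of the partial increment, and the read-out fit with a multiplicative constant on the increment's kit step
# (cell gate-hubbard-kl, seat hubbard-kl-k3c3-p2 g16; glue between k3c2-p3's RO-2 output at the BORN family and …TowerLevReadoutFit[F])

WHY.  k3c2-p3's RO-2 (KL STATUS 2026-08-29 l.10291) bounds the partial-block increment `𝒱_j − 𝒱_{dk}` at its BORN family `F_{dk}` in floor units at `J = dk`
(the in-tree analysis-overlap doors are one-step, `E(F_{dk})·S(F̃_{dk−1})`): `27^{t+1}·klLevNormOf … (dk) (2p) (𝒱_j − 𝒱_{dk}) Ωe / klLevUnitF … t p (dk) ≤ kit`.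
The read-out needs the same element at its OWN family `F_j`, `dk < j`: one application of the target-generic jump row (`klLevNormOf_jump_le_klEng_uniform`,
constants `C₁, C₂`) and of the floor unit algebra (`jumpPow_mul_div_klLevUnitF_add`: the jump factor over the unit ratio is the pure gain `((2^{e_F})⁻¹)^{j−dk} ≤ 1`)
gives the bound at `F_j` times `C₁C₂^{2p−1} = (C₁/C₂)·(C₂²)^p`; the fit `towerReadout_le_of_ro_mul` accepts exactly such a multiplicative constant on the kit step
(`Q_tot` absorbs `D_inc = C₂²`, `A_tot` absorbs `C_inc = C₁/C₂`).

* §1 `sub_momentumConserving`, **`partialIncr_momentumConserving`** — `𝒱_j − 𝒱_{dk}` annihilates the non-conserving leg strings;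
* §2 **`floorJump_readout_le`** — for any momentum-conserving `T`, `J + 1 ≤ J′ ≤ n_β + 1`, `t + 2 ≤ 2p`, `3 ≤ p`: if every level-`(t+1)` prescription at `F_J` has
  `27^{t+1}·klLevNormOf … J (2p) T Ωe′ / klLevUnitF … t p J ≤ N`, then every level-`(t+1)` prescription at `F_{J′}` has
  `klLevNormOf … J′ (2p) T Ωe / klLevUnitF … t p J′ ≤ (C₁/C₂)·(C₂²)^p·N`;
* §3 **`towerReadout_le_of_ro_mul`**, **`readoutBracket_le_law_mul`** — E1 part 7 with `inc ≤ C_inc·D_inc^p·kit` and the bracket under one law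
  `A_tot·Q_tot^p`, `Q_tot = D_inc·max 1 (max Q_ro (max (4Q″) (2τψQ″)))`, `A_tot = A_ro + C_inc·(A″x₁/(1−x₁) + eψ·τY·y/(1−y))`.
Compositions of landed theorems and real algebra; nothing about the model is asserted beyond them; nothing asserts (ℓ), any stub, K3 or superconductivity.
References: BGM 2006 §2.8 (2.82)–(2.84), (2.88)–(2.90), (2.93)–(2.98) [cite: BenfattoGiulianiMastropietro2006].
-/

noncomputable section

namespace Summit.HubbardSuperconductivity.HubbardSuperconductivity.Theorems.EngineV8

set_option linter.dupNamespace false -- summit = problem name (single-conjunct summit), D-0017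

open Classical
open Real Finset Literature.MathematicalPhysics.QuantumLattice Literature.Probability.LatticeModels GrassmannAlgebra
open Literature.MathematicalPhysics.QuantumLattice.FermiRG
open Summit.HubbardSuperconductivity.HubbardSuperconductivity.Theorems.KLProgrammeLegKernels
open Summit.HubbardSuperconductivity.HubbardSuperconductivity.Theorems.KLRegimeSplit
open Summit.HubbardSuperconductivity.HubbardSuperconductivity.Theorems.KLRegimeWick
open Summit.HubbardSuperconductivity.HubbardSuperconductivity.Theorems.TorusFourierL2
open Summit.HubbardSuperconductivity.HubbardSuperconductivity.Theorems.DispersionFlow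
open Summit.HubbardSuperconductivity.HubbardSuperconductivity.Theorems.PerturbedFermiCurve

variable {L M : ℕ} [NeZero L] [NeZero M]

/-! ## §1 Momentum conservation of differences and of the partial-block increment -/

omit [NeZero L] [NeZero M] in
/-- A difference of momentum-conserving elements is momentum-conserving. -/
theorem sub_momentumConserving {A B : HubbardGrassmann L M}
    (hA : ∀ (m : ℕ) (X : Fin m → HubbardFieldIdx L M), ∑ i, signedMomentum L (X i).2 (X i).1.1.2 ≠ 0 → kernel ℂ A m X = 0)
    (hB : ∀ (m : ℕ) (X : Fin m → HubbardFieldIdx L M), ∑ i, signedMomentum L (X i).2 (X i).1.1.2 ≠ 0 → kernel ℂ B m X = 0)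
    (m : ℕ) (X : Fin m → HubbardFieldIdx L M) (h : ∑ i, signedMomentum L (X i).2 (X i).1.1.2 ≠ 0) : kernel ℂ (A - B) m X = 0 := by
  rw [sub_eq_add_neg, kernel_add, ← neg_one_smul ℂ B, kernel_smul, hA m X h, hB m X h, mul_zero, add_zero]

/-- **The partial-block increment `𝒱_j − 𝒱_{dk}` is momentum-conserving.** -/
theorem partialIncr_momentumConserving (β U μ : ℝ) (K : TrigPolyC4v) (d k j m : ℕ) (X : Fin m → HubbardFieldIdx L M)
    (h : ∑ i, signedMomentum L (X i).2 (X i).1.1.2 ≠ 0) :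
    kernel ℂ (klEffectiveAction L M β U μ K klE0 j - klTowerInput L M β U μ K d k) m X = 0 := by
  unfold klTowerInput
  exact sub_momentumConserving (klEffectiveAction_momentumConserving β U μ K klE0 j) (klEffectiveAction_momentumConserving β U μ K klE0 (d * k)) m X h

/-! ## §2 The floor jump of a bound in floor units -/

omit [NeZero L] [NeZero M] in
/-- **A FLOOR-UNIT BOUND BORN AT `F_J` READ AT A FINER `F_{J′}`** (`J + 1 ≤ J′ ≤ n_β + 1`, `t + 2 ≤ 2p`, `3 ≤ p`): for every momentum-conserving `T`, if all
level-`(t+1)` prescriptions at `F_J` satisfy `27^{t+1}·klLevNormOf … J (2p) T Ωe′ / klLevUnitF … t p J ≤ N`, then all level-`(t+1)` prescriptions at `F_{J′}` satisfy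
`klLevNormOf … J′ (2p) T Ωe / klLevUnitF … t p J′ ≤ (C₁/C₂)·(C₂²)^p·N` — the jump factor `(2^{J′−J})^{2p−2−t}` against the unit ratio is the pure gain
`((2^{p+t−klLevGain t−3})⁻¹)^{J′−J} ≤ 1`. [cite: BenfattoGiulianiMastropietro2006, §2.8 (2.82)-(2.84), (2.88)-(2.90)] -/
theorem floorJump_readout_le :
    ∃ C₁ C₂ : ℝ, 0 < C₁ ∧ 0 < C₂ ∧ ∀ R : RenConsts, R.WF2 → ∃ c₃' : ℝ, 0 < c₃' ∧ ∃ U₀' : ℝ, 0 < U₀' ∧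
      ∀ (P : SplitConsts) (c : ℝ), P.WF → 0 < c → c ≤ klEngC₃6 P R → c ≤ c₃' →
      ∀ μ ∈ klWindowC, ∀ U : ℝ, 0 < U → U ≤ klEngU₀9 P R c → U ≤ U₀' → ∀ β : ℝ, klBetaMin ≤ β → β ≤ Real.exp (c / U ^ 2) →
      ∀ K : TrigPolyC4v, FrameOK R U (nScales β) μ K → ∀ (L M : ℕ) [NeZero L] [NeZero M],
      klEngL₃ β U ≤ L → klEngM₃ β U L ≤ M → ∀ J J' : ℕ, J + 1 ≤ J' → J' ≤ nScales β + 1 →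
      ∀ T : HubbardGrassmann L M,
        (∀ (m' : ℕ) (X : Fin m' → HubbardFieldIdx L M), ∑ i, signedMomentum L (X i).2 (X i).1.1.2 ≠ 0 → kernel ℂ T m' X = 0) →
      ∀ (t : Fin 5) (p : ℕ), (t : ℕ) + 2 ≤ 2 * p → 3 ≤ p → ∀ N : ℝ, 0 ≤ N →
        (∀ Ωe' : Fin (2 * p) → Option (SectorLeg (sectorCount J)), levelCount Ωe' = (t : ℕ) + 1 →
          (27 : ℝ) ^ ((t : ℕ) + 1) * klLevNormOf L M β μ K J (2 * p) T Ωe' / klLevUnitF β M t p J ≤ N) →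
        ∀ Ωe : Fin (2 * p) → Option (SectorLeg (sectorCount J')), levelCount Ωe = (t : ℕ) + 1 →
          klLevNormOf L M β μ K J' (2 * p) T Ωe / klLevUnitF β M t p J' ≤ C₁ / C₂ * (C₂ ^ 2) ^ p * N := by
  obtain ⟨C₁, C₂, hC₁, hC₂, h⟩ := klLevNormOf_jump_le_klEng_uniform
  refine ⟨C₁, C₂, hC₁, hC₂, fun R hR2 => ?_⟩
  obtain ⟨c₃, hc₃, U₀, hU₀, h'⟩ := h R hR2
  refine ⟨c₃, hc₃, U₀, hU₀, ?_⟩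
  intro P c hP hc hc6 hc₃' μ hμ U hU hU9 hU₀' β hβmin hβc K hK L M _ _ hL3 hM3 J J' hJ hJN T hT t p h1 h3 N hN0 hN Ωe hlev
  have hβ : 0 < β := KLRegimeSplit.pos_of_klBetaMin_le hβmin
  have huJ : 0 < klLevUnitF β M t p J := klLevUnitF_pos hβ t p J
  have huJ' : 0 < klLevUnitF β M t p J' := klLevUnitF_pos hβ t p J'
  have h27 : (1 : ℝ) ≤ (27 : ℝ) ^ ((t : ℕ) + 1) := one_le_pow₀ (by norm_num)
  -- the absolute bound at the born family: `klLevNormOf … J … Ωe′ ≤ N·unitF(J)`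
  set N₀ : ℝ := N * klLevUnitF β M t p J with hN₀
  have hN₀0 : 0 ≤ N₀ := by positivity
  have hN' : ∀ Ωe' : Fin (2 * p) → Option (SectorLeg (sectorCount J)), levelCount Ωe' = levelCount Ωe →
      klLevNormOf L M β μ K J (2 * p) T Ωe' ≤ N₀ := by
    intro Ωe' hlev'
    rw [hlev] at hlev'
    have hx0 : 0 ≤ klLevNormOf L M β μ K J (2 * p) T Ωe' := klLevNormOf_nonneg hβ.le μ K J (2 * p) T Ωe'
    have h2 := hN Ωe' hlev'
    rw [div_le_iff₀ huJ] at h2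
    calc klLevNormOf L M β μ K J (2 * p) T Ωe' ≤ (27 : ℝ) ^ ((t : ℕ) + 1) * klLevNormOf L M β μ K J (2 * p) T Ωe' :=
          le_mul_of_one_le_left hx0 h27
      _ ≤ N * klLevUnitF β M t p J := h2
  have hjump₀ := h' (2 * p - 1) P c hP hc hc6 hc₃' μ hμ U hU hU9 hU₀' β hβmin hβc K hK L M hL3 hM3 J J' hJ hJN T hT
  rw [show 2 * p - 1 + 1 = 2 * p by omega] at hjump₀
  have hjump := hjump₀ Ωe N₀ hN₀0 hN'
  rw [hlev] at hjump
  -- divide by the unit at `J′` and use the unit algebra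
  obtain ⟨Δ, hΔ⟩ : ∃ Δ, J' = J + Δ := ⟨J' - J, by omega⟩
  have hΔ' : J' - J = Δ := by omega
  set e : ℕ := p + (t : ℕ) - klLevGain t - 3 with he
  have hb : ((2 : ℝ) ^ e)⁻¹ ≤ 1 := inv_le_one_of_one_le₀ (one_le_pow₀ (by norm_num))
  have hb0 : 0 ≤ ((2 : ℝ) ^ e)⁻¹ := by positivity
  have hC : C₁ * C₂ ^ (2 * p - 1) = C₁ / C₂ * (C₂ ^ 2) ^ p := by
    have hpw : (C₂ ^ 2) ^ p = C₂ ^ (2 * p - 1) * C₂ := by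
      rw [← pow_mul, ← pow_succ]; congr 1; omega
    rw [hpw]
    field_simp
  calc klLevNormOf L M β μ K J' (2 * p) T Ωe / klLevUnitF β M t p J'
      ≤ C₁ * C₂ ^ (2 * p - 1) * ((2 : ℝ) ^ (J' - J)) ^ (2 * p - 1 - ((t : ℕ) + 1)) * N₀ / klLevUnitF β M t p J' :=
        div_le_div_of_nonneg_right hjump huJ'.le
    _ = C₁ * C₂ ^ (2 * p - 1) * ((((2 : ℝ) ^ e)⁻¹) ^ Δ * (N₀ / klLevUnitF β M t p J)) := by
        rw [hΔ', mul_assoc (C₁ * C₂ ^ (2 * p - 1)), mul_div_assoc, hΔ, jumpPow_mul_div_klLevUnitF_add (M := M) hβ t h1 h3 J Δ N₀]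
    _ = C₁ * C₂ ^ (2 * p - 1) * (((2 : ℝ) ^ e)⁻¹ ^ Δ * N) := by rw [hN₀, mul_div_assoc, div_self huJ.ne', mul_one]
    _ ≤ C₁ * C₂ ^ (2 * p - 1) * (1 * N) := by
        exact mul_le_mul_of_nonneg_left (mul_le_mul_of_nonneg_right (pow_le_one₀ hb0 hb) hN0) (by positivity)
    _ = C₁ / C₂ * (C₂ ^ 2) ^ p * N := by rw [one_mul, hC]

/-! ## §3 The read-out fit with a multiplicative constant on the increment's kit step -/

/-- **E1 part 7 with the re-measured part under its own profile and a CONSTANT `C_inc·D_inc^p` on the increment's kit step** (`C_inc, D_inc > 0`):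
`pub ≤ ro + inc`, `ro ≤ A_ro λ^{p−1} Q_ro^p`, `inc ≤ C_inc·D_inc^p·kit(μ)` under the Chernoff data and the five smallness rows ⇒
`pub ≤ λ^{p−1}·(A_ro Q_ro^p + C_inc·D_inc^p·(A″(4Q″)^p·x₁/(1−x₁) + e·ψ·(2τψQ″)^{p−1}·τY·y/(1−y)))`. [cite: BenfattoGiulianiMastropietro2006, §2.8 (2.93)-(2.98)] -/
theorem towerReadout_le_of_ro_mul {D : ℕ} {μ : ℕ → ℝ} {pub ro inc σ Φ ψ τ lam A'' Q'' ι₁ ι₂ ι₃ Aro Qro Cinc Dinc : ℝ}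
    (hσ : 0 ≤ σ) (hΦ : 0 ≤ Φ) (hψ : 0 ≤ ψ) (hτ : 0 < τ) (hlam : 0 < lam) (hA'' : 0 ≤ A'') (hQ'' : 0 < Q'') (hCinc : 0 < Cinc) (hDinc : 0 < Dinc)
    (hμ0 : ∀ m, 0 ≤ μ m) (hι₁ : μ 1 ≤ ι₁ * lam) (hι₂ : μ 2 ≤ ι₂ * lam) (hι₃ : μ 3 ≤ ι₃ * lam ^ 2)
    (hprof : ∀ m, 4 ≤ m → m ≤ D → μ m ≤ A'' * lam ^ (m - 1) * Q'' ^ m)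
    (hx₁ : 4 * σ * lam * Q'' < 1) (hx₂ : 2 * lam * τ * Q'' ≤ 1) (hx₃ : exp 1 * τ * lam * Q'' < 1)
    (hy : Φ * (τ * (ι₁ * lam + ι₂ / (2 * Q'') + ι₃ / (4 * Q'' ^ 2) + A'' * Q'' / 4)) < 1)
    (hθ : Φ * (exp 1 * τ * (ι₁ * lam) + (exp 1 * τ) ^ 2 * (ι₂ * lam) + (exp 1 * τ) ^ 3 * (ι₃ * lam ^ 2) +
      A'' * (exp 1 * τ * Q'') * ((exp 1 * τ * lam * Q'') ^ 3 / (1 - exp 1 * τ * lam * Q''))) < 1)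
    {p : ℕ} (hp : 3 ≤ p) (hpub : pub ≤ ro + inc) (hro : ro ≤ Aro * lam ^ (p - 1) * Qro ^ p)
    (hstep : ∀ N : ℕ, 2 ≤ N → Φ * towerV D τ μ < 1 →
      inc ≤ Cinc * Dinc ^ p * (towerFO D σ μ p + ∑ n ∈ Icc 2 N, exp 1 * Φ ^ (n - 1) * ψ ^ p * towerS D τ μ n p +
        ψ ^ p * exp 1 * towerV D τ μ * (Φ * towerV D τ μ) ^ N / (1 - Φ * towerV D τ μ))) :
    pub ≤ lam ^ (p - 1) * (Aro * Qro ^ p + Cinc * Dinc ^ p * (A'' * (4 * Q'') ^ p * (4 * σ * lam * Q'' / (1 - 4 * σ * lam * Q'')) +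
      exp 1 * ψ * (2 * τ * ψ * Q'') ^ (p - 1) * (τ * (ι₁ * lam + ι₂ / (2 * Q'') + ι₃ / (4 * Q'' ^ 2) + A'' * Q'' / 4)) *
        (Φ * (τ * (ι₁ * lam + ι₂ / (2 * Q'') + ι₃ / (4 * Q'' ^ 2) + A'' * Q'' / 4)) /
          (1 - Φ * (τ * (ι₁ * lam + ι₂ / (2 * Q'') + ι₃ / (4 * Q'' ^ 2) + A'' * Q'' / 4)))))) := by
  have hCD : 0 < Cinc * Dinc ^ p := by positivity
  have hinc := towerReadoutIncrement_le (D := D) (inc := inc / (Cinc * Dinc ^ p)) hσ hΦ hψ hτ hlam hA'' hQ'' hμ0 hι₁ hι₂ hι₃ hprof hx₁ hx₂ hx₃ hy hθ hp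
    (fun N hN hg => by rw [div_le_iff₀ hCD, mul_comm]; exact hstep N hN hg)
  rw [div_le_iff₀ hCD] at hinc
  have hro' : ro ≤ lam ^ (p - 1) * (Aro * Qro ^ p) := by rw [← mul_assoc, mul_comm (lam ^ (p - 1))]; exact hro
  refine hpub.trans ((add_le_add hro' hinc).trans (le_of_eq ?_))
  ring

/-- **The bracket with the increment constant under one law**: `Q_tot = D_inc · max 1 (max Q_ro (max (4Q″) (2τψQ″)))`,
`A_tot = A_ro + C_inc·(A″X₁ + eψ·TY·Yy)` (`C_inc ≥ 0`, `D_inc ≥ 1`). [folklore] -/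
theorem readoutBracket_le_law_mul {Aro Qro A'' Q'' ψ τ X₁ TY Yy Cinc Dinc : ℝ} (hAro : 0 ≤ Aro) (hQro : 0 ≤ Qro) (hA'' : 0 ≤ A'')
    (hQ'' : 0 ≤ Q'') (hψ : 0 ≤ ψ) (hτ : 0 ≤ τ) (hX₁ : 0 ≤ X₁) (hTY : 0 ≤ TY) (hYy : 0 ≤ Yy) (hCinc : 0 ≤ Cinc) (hDinc : 1 ≤ Dinc) (p : ℕ) :
    Aro * Qro ^ p + Cinc * Dinc ^ p * (A'' * (4 * Q'') ^ p * X₁ + exp 1 * ψ * (2 * τ * ψ * Q'') ^ (p - 1) * TY * Yy) ≤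
      (Aro + Cinc * (A'' * X₁ + exp 1 * ψ * TY * Yy)) * (Dinc * max 1 (max Qro (max (4 * Q'') (2 * τ * ψ * Q'')))) ^ p := by
  have hD0 : 0 ≤ Dinc := zero_le_one.trans hDinc
  set Mq : ℝ := max 1 (max Qro (max (4 * Q'') (2 * τ * ψ * Q''))) with hMq
  have hM1 : 1 ≤ Mq := le_max_left _ _
  have hM0 : 0 ≤ Mq := zero_le_one.trans hM1
  have h1 : Qro ≤ Mq := (le_max_left _ _).trans (le_max_right _ _)
  have h2 : 4 * Q'' ≤ Mq := ((le_max_left _ _).trans (le_max_right _ _)).trans (le_max_right _ _)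
  have h3 : 2 * τ * ψ * Q'' ≤ Mq := ((le_max_right _ _).trans (le_max_right _ _)).trans (le_max_right _ _)
  have hDp : 1 ≤ Dinc ^ p := one_le_pow₀ hDinc
  have hp1 : Qro ^ p ≤ (Dinc * Mq) ^ p := by
    rw [mul_pow Dinc Mq p]
    exact (pow_le_pow_left₀ hQro h1 p).trans (le_mul_of_one_le_left (pow_nonneg hM0 _) hDp)
  have hp2 : Dinc ^ p * (4 * Q'') ^ p ≤ (Dinc * Mq) ^ p := by
    rw [mul_pow Dinc Mq p]; exact mul_le_mul_of_nonneg_left (pow_le_pow_left₀ (by positivity) h2 p) (by positivity)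
  have hp3 : Dinc ^ p * (2 * τ * ψ * Q'') ^ (p - 1) ≤ (Dinc * Mq) ^ p := by
    rw [mul_pow Dinc Mq p]
    refine mul_le_mul_of_nonneg_left ?_ (by positivity)
    exact (pow_le_pow_left₀ (by positivity) h3 (p - 1)).trans (pow_le_pow_right₀ hM1 (Nat.sub_le p 1))
  have he : 0 ≤ exp 1 * ψ := by positivity
  calc Aro * Qro ^ p + Cinc * Dinc ^ p * (A'' * (4 * Q'') ^ p * X₁ + exp 1 * ψ * (2 * τ * ψ * Q'') ^ (p - 1) * TY * Yy)
      = Aro * Qro ^ p + Cinc * (A'' * (Dinc ^ p * (4 * Q'') ^ p) * X₁ + exp 1 * ψ * (Dinc ^ p * (2 * τ * ψ * Q'') ^ (p - 1)) * TY * Yy) := by ring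
    _ ≤ Aro * (Dinc * Mq) ^ p + Cinc * (A'' * (Dinc * Mq) ^ p * X₁ + exp 1 * ψ * (Dinc * Mq) ^ p * TY * Yy) := by
        refine add_le_add (mul_le_mul_of_nonneg_left hp1 hAro) (mul_le_mul_of_nonneg_left (add_le_add ?_ ?_) hCinc)
        · exact mul_le_mul_of_nonneg_right (mul_le_mul_of_nonneg_left hp2 hA'') hX₁
        · exact mul_le_mul_of_nonneg_right (mul_le_mul_of_nonneg_right (mul_le_mul_of_nonneg_left hp3 he) hTY) hYy
    _ = (Aro + Cinc * (A'' * X₁ + exp 1 * ψ * TY * Yy)) * (Dinc * Mq) ^ p := by ring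

end Summit.HubbardSuperconductivity.HubbardSuperconductivity.Theorems.EngineV8

end
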